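import Literature.Algebra.Polynomial.FischerDecomposition
import Mathlib.Algebra.MvPolynomial.PDeriv
import Mathlib.RingTheory.MvPolynomial.Homogeneous
import HarnessLib

/-!
# The harmonic Fischer normal form `P = Σ_m (Σᵢ xᵢ²)^{e_m} · H_m`

Every real polynomial in finitely many variables is a finite sum of products of powers of
`r² = Σᵢ xᵢ²` with *harmonic* homogeneous polynomials (`Δ H = Σᵢ ∂ᵢ² H = 0`).  This is the
iterated form of the classical decomposition `𝒫ᵏ = ℋᵏ ⊕ r² 𝒫ᵏ⁻²` of homogeneous polynomials of
degree `k` (Axler–Bourdon–Ramey, *Harmonic Function Theory*, Prop. 5.5 and Thm. 5.7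
[AxlerBourdonRamey2001]; Goodman–Wallach GTM 255 § 5.6.4, the case `S = {r²}` of Lemma 5.1.5
[GoodmanWallachGTM255]; Fischer 1918).

The proof is bookkeeping on top of the tree's graded Fischer decomposition
`Literature.Algebra.Polynomial.FischerDecomposition.exists_harmonic_add_mem_span` (Goodman–Wallach
Lemma 5.1.5 for an arbitrary set `S` of homogeneous polynomials): with `S = {r²}` and `D` the
algebra homomorphism `f ↦ ∂(f)` of `exists_algHom_pderiv` one has `∂(r²) = Δ`, so a homogeneous
`f` of degree `k` is `h + q` with `Δ h = 0` and `q ∈ (r²)`; comparing homogeneous components,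
`q = r² · c` with `c` homogeneous of degree `k - 2` (and `q = 0` if `k < 2`), and strong induction
on `k` gives the normal form for homogeneous polynomials; a general polynomial is the sum of its
homogeneous components.

Main results (all over `ℝ`, any finite index type `ι`):

* `laplacian_eq_algHom_pderiv_sum_sq` — `∂(Σᵢ xᵢ²) h = Σᵢ ∂ᵢ² h`;
* `exists_harmonic_add_sum_sq_mul_of_isHomogeneous` — `𝒫ᵏ = ℋᵏ + r² 𝒫ᵏ⁻²` elementwise;
* `exists_sum_sq_pow_mul_harmonic_of_isHomogeneous` — the normal form for homogeneous polynomials;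
* `exists_sum_sq_pow_mul_harmonic` — the normal form for every polynomial.

Uniqueness of the normal form (also part of ABR Thm. 5.7) is deliberately NOT formalised here.
The file is definition-free: "harmonic" is spelled `∑ i, pderiv i (pderiv i H) = 0` and `r²` is
spelled `∑ i, X i ^ 2`, so that users with their own abbreviations can instantiate by `rfl`.
-/

open MvPolynomial
open scoped BigOperators

namespace Literature.Algebra.Polynomial.FischerDecomposition

noncomputable section

variable {ι : Type*} [Fintype ι]

/-! ## § 0. Two folklore facts on homogeneous components of a product -/

/-- `(φ ψ)_{i+j} = φ · ψ_j` for `φ` homogeneous of degree `i`. [folklore] -/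
private theorem homogeneousComponent_mul_left_of_isHomogeneous {R : Type*} [CommSemiring R] {σ : Type*}
    {φ ψ : MvPolynomial σ R} {i : ℕ} (hφ : φ.IsHomogeneous i) (j : ℕ) :
    homogeneousComponent (i + j) (φ * ψ) = φ * homogeneousComponent j ψ := by
  classical
  conv_lhs => rw [← sum_homogeneousComponent ψ, Finset.mul_sum, map_sum]
  have key : ∀ l ∈ Finset.range (ψ.totalDegree + 1),
      homogeneousComponent (i + j) (φ * homogeneousComponent l ψ) =
        if l = j then φ * homogeneousComponent j ψ else 0 := by
    intro l _
    rw [homogeneousComponent_of_mem (hφ.mul (homogeneousComponent_isHomogeneous l ψ))]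
    by_cases hl : l = j
    · subst hl; simp
    · have hne : i + j ≠ i + l := fun h => hl (by omega)
      rw [if_neg hne, if_neg hl]
  rw [Finset.sum_congr rfl key, Finset.sum_ite_eq' (Finset.range (ψ.totalDegree + 1)) j]
  split_ifs with hj
  · rfl
  · rw [homogeneousComponent_eq_zero]
    · simp
    · rw [Finset.mem_range, not_lt] at hj
      omega

/-- `(φ ψ)_n = 0` for `n < i` and `φ` homogeneous of degree `i`. [folklore] -/
private theorem homogeneousComponent_mul_eq_zero_of_lt_left {R : Type*} [CommSemiring R] {σ : Type*}
    {φ ψ : MvPolynomial σ R} {i n : ℕ} (hφ : φ.IsHomogeneous i) (hn : n < i) :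
    homogeneousComponent n (φ * ψ) = 0 := by
  classical
  conv_lhs => rw [← sum_homogeneousComponent ψ, Finset.mul_sum, map_sum]
  refine Finset.sum_eq_zero fun l _ => ?_
  rw [homogeneousComponent_of_mem (hφ.mul (homogeneousComponent_isHomogeneous l ψ))]
  have hne : n ≠ i + l := by omega
  simp [hne]

/-! ## § 1. `∂(r²) = Δ` and the one-step decomposition `𝒫ᵏ = ℋᵏ + r²·𝒫ᵏ⁻²` -/

/-- `r² = Σᵢ xᵢ²` is homogeneous of degree `2`. [folklore] -/
private theorem isHomogeneous_sum_X_sq : (∑ i : ι, (X i : MvPolynomial ι ℝ) ^ 2).IsHomogeneous 2 :=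
  IsHomogeneous.sum _ _ _ fun i _ => isHomogeneous_X_pow i 2

/-- For the algebra homomorphism `f ↦ ∂(f)` (`∂(xᵢ) = ∂ᵢ`): `∂(Σᵢ xᵢ²) h = Σᵢ ∂ᵢ² h = Δ h`.
[cite: GoodmanWallachGTM255, §5.6.4 (harmonic polynomials: ∂(r²) = Δ)] -/
theorem laplacian_eq_algHom_pderiv_sum_sq
    (D : MvPolynomial ι ℝ →ₐ[ℝ] Module.End ℝ (MvPolynomial ι ℝ))
    (hD : ∀ i, D (X i) =
      ((pderiv i : Derivation ℝ (MvPolynomial ι ℝ) (MvPolynomial ι ℝ)) :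
        Module.End ℝ (MvPolynomial ι ℝ)))
    (h : MvPolynomial ι ℝ) :
    D (∑ i : ι, X i ^ 2) h = ∑ i : ι, pderiv i (pderiv i h) := by
  rw [map_sum, LinearMap.sum_apply]
  refine Finset.sum_congr rfl fun i _ => ?_
  rw [map_pow, hD i, pow_two, Module.End.mul_apply]
  rfl

/-- **`𝒫ᵏ = ℋᵏ + r²·𝒫ᵏ⁻²`, elementwise** (ABR Prop. 5.5 / Goodman–Wallach Lemma 5.1.5 with `S = {r²}`):
a homogeneous polynomial `f` of degree `k` is `f = h + r²·c` with `h` harmonic homogeneous of degree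
`k` and `c` homogeneous of degree `k - 2` (for `k < 2` we produce `c = 0`).
[cite: AxlerBourdonRamey2001, Prop. 5.5] -/
theorem exists_harmonic_add_sum_sq_mul_of_isHomogeneous {k : ℕ} {f : MvPolynomial ι ℝ}
    (hf : f.IsHomogeneous k) :
    ∃ h c : MvPolynomial ι ℝ, h.IsHomogeneous k ∧ (∑ i : ι, pderiv i (pderiv i h)) = 0 ∧
      c.IsHomogeneous (k - 2) ∧ f = h + (∑ i : ι, X i ^ 2) * c := by
  classical
  obtain ⟨D, hD⟩ := exists_algHom_pderiv (ι := ι)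
  set r2 : MvPolynomial ι ℝ := ∑ i : ι, X i ^ 2 with hr2
  have hr2h : r2.IsHomogeneous 2 := isHomogeneous_sum_X_sq
  have hS : ∀ g ∈ ({r2} : Set (MvPolynomial ι ℝ)), ∃ d, g.IsHomogeneous d := by
    intro g hg
    rw [Set.mem_singleton_iff] at hg
    exact ⟨2, hg ▸ hr2h⟩
  obtain ⟨h, q, hh, hharm, hq, hqI, hfq⟩ := exists_harmonic_add_mem_span D hD hS hf
  have hΔ : (∑ i : ι, pderiv i (pderiv i h)) = 0 := by
    rw [← laplacian_eq_algHom_pderiv_sum_sq D hD h]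
    exact hharm r2 (Set.mem_singleton r2)
  obtain ⟨c, hc⟩ := Ideal.mem_span_singleton.mp hqI
  -- compare homogeneous components of `q = r² · c`
  by_cases hk : 2 ≤ k
  · obtain ⟨j, rfl⟩ : ∃ j, k = j + 2 := ⟨k - 2, by omega⟩
    refine ⟨h, homogeneousComponent j c, hh, hΔ,
      by simpa using homogeneousComponent_isHomogeneous j c, ?_⟩
    have hqk : homogeneousComponent (j + 2) q = q := by
      rw [homogeneousComponent_of_mem ((mem_homogeneousSubmodule (j + 2) q).mpr hq), if_pos rfl]
    have : q = r2 * homogeneousComponent j c := by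
      rw [← homogeneousComponent_mul_left_of_isHomogeneous hr2h j, ← hc, add_comm 2 j, hqk]
    rw [hfq, this]
  · refine ⟨h, 0, hh, hΔ, isHomogeneous_zero _ _ _, ?_⟩
    have hqk : homogeneousComponent k q = q := by
      rw [homogeneousComponent_of_mem ((mem_homogeneousSubmodule k q).mpr hq), if_pos rfl]
    have hq0 : q = 0 := by
      rw [← hqk, hc]
      exact homogeneousComponent_mul_eq_zero_of_lt_left hr2h (by omega)
    rw [hfq, hq0, mul_zero]

/-! ## § 2. The normal form -/

/-- **Harmonic Fischer normal form, homogeneous case** (ABR Thm. 5.7): a homogeneous polynomial of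
degree `k` is a finite sum `Σ_m (Σᵢ xᵢ²)^{e_m} · H_m` with `H_m` harmonic and homogeneous (of degree
`d_m`; in fact `d_m + 2 e_m = k`, not recorded). [cite: AxlerBourdonRamey2001, Thm. 5.7] -/
theorem exists_sum_sq_pow_mul_harmonic_of_isHomogeneous {k : ℕ} {f : MvPolynomial ι ℝ}
    (hf : f.IsHomogeneous k) :
    ∃ (M : ℕ) (H : Fin M → MvPolynomial ι ℝ) (d e : Fin M → ℕ),
      (∀ m, (H m).IsHomogeneous (d m)) ∧ (∀ m, (∑ i : ι, pderiv i (pderiv i (H m))) = 0) ∧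
      f = ∑ m, (∑ i : ι, X i ^ 2) ^ (e m) * H m := by
  induction k using Nat.strong_induction_on generalizing f with
  | _ k ih =>
    obtain ⟨h, c, hh, hΔ, hc, hfhc⟩ := exists_harmonic_add_sum_sq_mul_of_isHomogeneous hf
    by_cases hk : 2 ≤ k
    · obtain ⟨M, H, d, e, hH, hHΔ, hcsum⟩ := ih (k - 2) (by omega) hc
      refine ⟨M + 1, Fin.cons h H, Fin.cons k d, Fin.cons 0 (fun m => e m + 1), ?_, ?_, ?_⟩
      · intro m
        refine Fin.cases ?_ (fun m => ?_) m
        · simpa using hh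
        · simpa using hH m
      · intro m
        refine Fin.cases ?_ (fun m => ?_) m
        · simpa using hΔ
        · simpa using hHΔ m
      · rw [Fin.sum_univ_succ]
        simp only [Fin.cons_zero, Fin.cons_succ, pow_zero, one_mul]
        rw [hfhc, hcsum, Finset.mul_sum]
        refine congrArg (h + ·) (Finset.sum_congr rfl fun m _ => ?_)
        ring
    · -- `k < 2`: `c` is homogeneous of degree `k - 2 = 0`, but we only need `f = h + r²·c` with a
      -- harmonic `h`; since `f` and `h` are homogeneous of degree `k < 2` and `r²·c` has all its
      -- homogeneous components in degrees `≥ 2`, in fact `r²·c = 0`.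
      have hrc : (∑ i : ι, (X i : MvPolynomial ι ℝ) ^ 2) * c = 0 := by
        have hfk : (f - h).IsHomogeneous k := hf.sub hh
        have hfh : f - h = (∑ i : ι, (X i : MvPolynomial ι ℝ) ^ 2) * c := by
          rw [hfhc]; ring
        rw [← hfh]
        have h1 : homogeneousComponent k (f - h) = f - h := by
          rw [homogeneousComponent_of_mem ((mem_homogeneousSubmodule k _).mpr hfk), if_pos rfl]
        rw [← h1, hfh]
        exact homogeneousComponent_mul_eq_zero_of_lt_left isHomogeneous_sum_X_sq (by omega)
      refine ⟨1, fun _ => h, fun _ => k, fun _ => 0, fun _ => hh, fun _ => hΔ, ?_⟩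
      rw [hfhc, hrc, add_zero]
      simp

/-- Closure of the normal form under addition (concatenation of the two index sets). [folklore] -/
private theorem exists_sum_sq_pow_mul_harmonic_add {f g : MvPolynomial ι ℝ}
    (hf : ∃ (M : ℕ) (H : Fin M → MvPolynomial ι ℝ) (d e : Fin M → ℕ),
      (∀ m, (H m).IsHomogeneous (d m)) ∧ (∀ m, (∑ i : ι, pderiv i (pderiv i (H m))) = 0) ∧
      f = ∑ m, (∑ i : ι, X i ^ 2) ^ (e m) * H m)
    (hg : ∃ (M : ℕ) (H : Fin M → MvPolynomial ι ℝ) (d e : Fin M → ℕ),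
      (∀ m, (H m).IsHomogeneous (d m)) ∧ (∀ m, (∑ i : ι, pderiv i (pderiv i (H m))) = 0) ∧
      g = ∑ m, (∑ i : ι, X i ^ 2) ^ (e m) * H m) :
    ∃ (M : ℕ) (H : Fin M → MvPolynomial ι ℝ) (d e : Fin M → ℕ),
      (∀ m, (H m).IsHomogeneous (d m)) ∧ (∀ m, (∑ i : ι, pderiv i (pderiv i (H m))) = 0) ∧
      f + g = ∑ m, (∑ i : ι, X i ^ 2) ^ (e m) * H m := by
  obtain ⟨M, H, d, e, hH, hHΔ, rfl⟩ := hf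
  obtain ⟨M', H', d', e', hH', hHΔ', rfl⟩ := hg
  refine ⟨M + M', Fin.append H H', Fin.append d d', Fin.append e e', ?_, ?_, ?_⟩
  · intro m
    refine Fin.addCases (fun m => ?_) (fun m => ?_) m
    · simpa using hH m
    · simpa using hH' m
  · intro m
    refine Fin.addCases (fun m => ?_) (fun m => ?_) m
    · simpa using hHΔ m
    · simpa using hHΔ' m
  · rw [Fin.sum_univ_add]
    simp

/-- **Harmonic Fischer normal form** (ABR Thm. 5.7, summed over the homogeneous components): every
real polynomial in finitely many variables is a finite sum `Σ_m (Σᵢ xᵢ²)^{e_m} · H_m` with each `H_m`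
homogeneous (of some degree `d_m`) and harmonic, `Σᵢ ∂ᵢ² H_m = 0`.
[cite: AxlerBourdonRamey2001, Thm. 5.7] -/
theorem exists_sum_sq_pow_mul_harmonic (P : MvPolynomial ι ℝ) :
    ∃ (M : ℕ) (H : Fin M → MvPolynomial ι ℝ) (d e : Fin M → ℕ),
      (∀ m, (H m).IsHomogeneous (d m)) ∧ (∀ m, (∑ i : ι, pderiv i (pderiv i (H m))) = 0) ∧
      P = ∑ m, (∑ i : ι, X i ^ 2) ^ (e m) * H m := by
  classical
  rw [← sum_homogeneousComponent P]
  refine Finset.sum_induction _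
    (fun Q : MvPolynomial ι ℝ => ∃ (M : ℕ) (H : Fin M → MvPolynomial ι ℝ) (d e : Fin M → ℕ),
      (∀ m, (H m).IsHomogeneous (d m)) ∧ (∀ m, (∑ i : ι, pderiv i (pderiv i (H m))) = 0) ∧
      Q = ∑ m, (∑ i : ι, X i ^ 2) ^ (e m) * H m)
    (fun _ _ ha hb => exists_sum_sq_pow_mul_harmonic_add ha hb) ?_ ?_
  · exact ⟨0, Fin.elim0, Fin.elim0, Fin.elim0, fun m => m.elim0, fun m => m.elim0, by simp⟩
  · intro k _
    exact exists_sum_sq_pow_mul_harmonic_of_isHomogeneous (homogeneousComponent_isHomogeneous k P)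

/-- **Harmonic Fischer normal form with degrees** (ABR Thm. 5.7 as printed: `p = p_k + |x|² p_{k-2} + ⋯`): a
homogeneous polynomial of degree `k` is `Σ_m (Σᵢ xᵢ²)^{e_m} · H_m` with `H_m` harmonic, homogeneous of degree `d_m`, and
`d_m + 2 e_m = k` for every `m`. [cite: AxlerBourdonRamey2001, Thm. 5.7] -/
theorem exists_sum_sq_pow_mul_harmonic_of_isHomogeneous_degree {k : ℕ} {f : MvPolynomial ι ℝ}
    (hf : f.IsHomogeneous k) :
    ∃ (M : ℕ) (H : Fin M → MvPolynomial ι ℝ) (d e : Fin M → ℕ),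
      (∀ m, (H m).IsHomogeneous (d m)) ∧ (∀ m, (∑ i : ι, pderiv i (pderiv i (H m))) = 0) ∧
      (∀ m, d m + 2 * e m = k) ∧ f = ∑ m, (∑ i : ι, X i ^ 2) ^ (e m) * H m := by
  induction k using Nat.strong_induction_on generalizing f with
  | _ k ih =>
    obtain ⟨h, c, hh, hΔ, hc, hfhc⟩ := exists_harmonic_add_sum_sq_mul_of_isHomogeneous hf
    by_cases hk : 2 ≤ k
    · obtain ⟨M, H, d, e, hH, hHΔ, hdeg, hcsum⟩ := ih (k - 2) (by omega) hc
      refine ⟨M + 1, Fin.cons h H, Fin.cons k d, Fin.cons 0 (fun m => e m + 1), ?_, ?_, ?_, ?_⟩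
      · intro m
        refine Fin.cases ?_ (fun m => ?_) m
        · simpa using hh
        · simpa using hH m
      · intro m
        refine Fin.cases ?_ (fun m => ?_) m
        · simpa using hΔ
        · simpa using hHΔ m
      · intro m
        refine Fin.cases ?_ (fun m => ?_) m
        · simp
        · have := hdeg m
          simp only [Fin.cons_succ]
          omega
      · rw [Fin.sum_univ_succ]
        simp only [Fin.cons_zero, Fin.cons_succ, pow_zero, one_mul]
        rw [hfhc, hcsum, Finset.mul_sum]
        refine congrArg (h + ·) (Finset.sum_congr rfl fun m _ => ?_)
        ring
    · have hrc : (∑ i : ι, (X i : MvPolynomial ι ℝ) ^ 2) * c = 0 := by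
        have hfk : (f - h).IsHomogeneous k := hf.sub hh
        have hfh : f - h = (∑ i : ι, (X i : MvPolynomial ι ℝ) ^ 2) * c := by
          rw [hfhc]; ring
        rw [← hfh]
        have h1 : homogeneousComponent k (f - h) = f - h := by
          rw [homogeneousComponent_of_mem ((mem_homogeneousSubmodule k _).mpr hfk), if_pos rfl]
        rw [← h1, hfh]
        exact homogeneousComponent_mul_eq_zero_of_lt_left isHomogeneous_sum_X_sq (by omega)
      refine ⟨1, fun _ => h, fun _ => k, fun _ => 0, fun _ => hh, fun _ => hΔ, fun _ => by simp, ?_⟩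
      rw [hfhc, hrc, add_zero]
      simp

end

end Literature.Algebra.Polynomial.FischerDecomposition
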